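import Summits.RiemannHypothesis.RiemannHypothesis.Theorems.GroundBartaEvenWinsBeyondArchDeflationWindowImageRepr
import HarnessLib

/-!
# RiemannHypothesis / GroundBarta — rung 4 (`EvenWinsBeyondArch`, stmt-RiemannHypothesis-18807 / 18085):
# the window image of a trial vector under an ALMOST-EVERYWHERE majorant

Helper file (`--supports stmt-RiemannHypothesis-18085`), RH-free, Mathlib + landed tree files only, no
definitions, no named facts.  Prover B (gen 6 of unit `sr-gb-rung-b`).

`…DeflationWindowImage.lean` / `…DeflationWindowImageRepr.lean` (prover B, gen 3) prove that the explicit window image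
`F` of a trial vector `v ∈ L²` is square integrable and represents the closed form, `P(v,f) + 𝓔_c(v,f) − M_c∫Re(v f̄) =
∫Re(F f̄)`, under a majorant hypothesis at EVERY point of the open window: `∫₀^∞ ρ(t)|2v(y) − v(y−t) − v(y+t)| dt ≤ m(y)`
for all `y ∈ (-c, c)`, `m ∈ L²`.  For the trial vectors of the ENDPOINT CELL of the window ladder (`v = 𝟙_{[-c',c']}·g`
with `c' < c`: the vector is cut INSIDE the window) that hypothesis fails at the two points `y = ±c'`, where the
archimedean second differences have a logarithmically divergent absolute integral.  Both proofs only ever use the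
hypothesis for almost every `y`; this file records the corresponding statements with the hypothesis

  `∀ᵐ y, y ∈ (-c, c) → (t ↦ ρ(t)|2v(y) − v(y−t) − v(y+t)| integrable on (0,∞)) ∧ ∫₀^∞ ρ(t)|…| dt ≤ m(y)`:

* `dt_memLp_archLayer_ae`, `dt_windowImage_memLp_ae` — the archimedean layer / the window image is in `L²`;
* `dt_archLayer_repr_ae`, `dt_windowImage_repr_ae` — Fubini for the archimedean layer and the representation identity.

The proofs are those of the pointwise versions, verbatim up to the bookkeeping of the exceptional null set.
-/

set_option linter.dupNamespace false

noncomputable section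

open MeasureTheory Set Filter
open scoped Topology ENNReal NNReal ComplexConjugate BigOperators

namespace Summit.RiemannHypothesis.RiemannHypothesis.Theorems.EvenWinsBeyondArch

open Literature.NumberTheory.LFunctions Literature.NumberTheory.LFunctions.ConnesVanSuijlekom
open Summit.RiemannHypothesis.RiemannHypothesis.Theorems.OddSector
  (weilIncrement₂ weilDirichletEnergy₂ weilPoleForm₂)

variable {c : ℝ} {v f : ℝ → ℂ}

/-! ## The window image is square integrable -/

/-- **The archimedean layer of the window image is in `L²`** under an a.e. majorant:
`𝟙_{[-c,c]} · ∫₀^∞ ρ(t)(2v − v(·−t) − v(·+t)) dt ∈ L²`. [cite: Bombieri2000Weil, §4 Lemma 1 eq. (4.2)] -/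
theorem dt_memLp_archLayer_ae (hv : MemLp v 2) {m : ℝ → ℝ} (hm : MemLp m 2)
    (hH : ∀ᵐ y : ℝ, y ∈ Ioo (-c) c →
      IntegrableOn (fun t ↦ weilArchDensity t * ‖2 * v y - v (y - t) - v (y + t)‖) (Ioi 0) ∧
        ∫ t in Ioi 0, weilArchDensity t * ‖2 * v y - v (y - t) - v (y + t)‖ ≤ m y) :
    MemLp (fun y ↦ (Icc (-c) c).indicator
      (fun y ↦ ∫ t in Ioi 0, (weilArchDensity t : ℂ) * (2 * v y - v (y - t) - v (y + t))) y) 2 := by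
  have hmeas : AEStronglyMeasurable
      (fun y ↦ ∫ t in Ioi 0, (weilArchDensity t : ℂ) * (2 * v y - v (y - t) - v (y + t))) volume := by
    have hρ : AEStronglyMeasurable (fun p : ℝ × ℝ ↦ (weilArchDensity p.2 : ℂ))
        ((volume : Measure ℝ).prod ((volume : Measure ℝ).restrict (Ioi 0))) :=
      (Complex.continuous_ofReal.measurable.comp measurable_weilArchDensity).aestronglyMeasurable.comp_snd
    exact (hρ.mul (dt_aesm_secondDiff_restrict hv.1)).integral_prod_right'
  have h1 : MemLp ((Icc (-c) c).indicator fun y ↦ ‖m y‖) 2 volume := hm.norm.indicator measurableSet_Icc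
  have h2 : AEStronglyMeasurable ((Icc (-c) c).indicator fun y ↦
      ∫ t in Ioi 0, (weilArchDensity t : ℂ) * (2 * v y - v (y - t) - v (y + t))) volume :=
    hmeas.indicator measurableSet_Icc
  refine MemLp.of_le h1 h2 ?_
  have hc1 : ∀ᵐ y : ℝ, y ∉ ({-c, c} : Set ℝ) :=
    measure_eq_zero_iff_ae_notMem.1 ((Set.toFinite ({-c, c} : Set ℝ)).measure_zero volume)
  filter_upwards [hc1, hH] with y hy hHy
  by_cases hyI : y ∈ Icc (-c) c
  · have hyo : y ∈ Ioo (-c) c := by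
      simp only [mem_insert_iff, mem_singleton_iff, not_or] at hy
      exact ⟨lt_of_le_of_ne hyI.1 (Ne.symm hy.1), lt_of_le_of_ne hyI.2 hy.2⟩
    rw [indicator_of_mem hyI, indicator_of_mem hyI, Real.norm_eq_abs, abs_norm]
    calc ‖∫ t in Ioi 0, (weilArchDensity t : ℂ) * (2 * v y - v (y - t) - v (y + t))‖
        ≤ ∫ t in Ioi 0, ‖(weilArchDensity t : ℂ) * (2 * v y - v (y - t) - v (y + t))‖ :=
          norm_integral_le_integral_norm _
      _ = ∫ t in Ioi 0, weilArchDensity t * ‖2 * v y - v (y - t) - v (y + t)‖ := by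
          refine setIntegral_congr_fun measurableSet_Ioi fun t ht ↦ ?_
          rw [norm_mul, Complex.norm_real, Real.norm_of_nonneg (weilArchDensity_pos ht).le]
      _ ≤ m y := (hHy hyo).2
      _ ≤ ‖m y‖ := le_abs_self _
  · simp [indicator_of_notMem hyI]

/-- **The window image is in `L²`** under an a.e. majorant. [cite: Bombieri2000Weil, §4 Lemma 1 eq. (4.2)] -/
theorem dt_windowImage_memLp_ae {F : ℝ → ℂ} (hv : MemLp v 2) {m : ℝ → ℝ} (hm : MemLp m 2)
    (hH : ∀ᵐ y : ℝ, y ∈ Ioo (-c) c →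
      IntegrableOn (fun t ↦ weilArchDensity t * ‖2 * v y - v (y - t) - v (y + t)‖) (Ioi 0) ∧
        ∫ t in Ioi 0, weilArchDensity t * ‖2 * v y - v (y - t) - v (y + t)‖ ≤ m y)
    (hF : ∀ y, F y = (Icc (-c) c).indicator (fun y ↦
        2 * (∫ x, v x * (Real.cosh (x / 2) : ℂ)) * (Real.cosh (y / 2) : ℂ) -
          2 * (∫ x, v x * (Real.sinh (x / 2) : ℂ)) * (Real.sinh (y / 2) : ℂ) +
        (∑ n ∈ weilPrimeIndex c, (((ArithmeticFunction.vonMangoldt n : ℝ) / Real.sqrt n : ℝ) : ℂ) *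
          (2 * v y - v (y - Real.log n) - v (y + Real.log n))) +
        ∫ t in Ioi 0, (weilArchDensity t : ℂ) * (2 * v y - v (y - t) - v (y + t))) y -
      (weilMarkovConstant c : ℂ) * v y) :
    MemLp F 2 := by
  have eF : F = (Icc (-c) c).indicator (fun y ↦
        2 * (∫ x, v x * (Real.cosh (x / 2) : ℂ)) * (Real.cosh (y / 2) : ℂ) -
          2 * (∫ x, v x * (Real.sinh (x / 2) : ℂ)) * (Real.sinh (y / 2) : ℂ)) +
      ((Icc (-c) c).indicator (fun y ↦
        ∑ n ∈ weilPrimeIndex c, (((ArithmeticFunction.vonMangoldt n : ℝ) / Real.sqrt n : ℝ) : ℂ) *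
          (2 * v y - v (y - Real.log n) - v (y + Real.log n))) +
      ((Icc (-c) c).indicator (fun y ↦
        ∫ t in Ioi 0, (weilArchDensity t : ℂ) * (2 * v y - v (y - t) - v (y + t))) -
      fun y ↦ (weilMarkovConstant c : ℂ) * v y)) := by
    funext y
    rw [hF y]
    simp only [Pi.add_apply, Pi.sub_apply]
    by_cases hy : y ∈ Icc (-c) c
    · simp only [indicator_of_mem hy]; ring
    · simp only [indicator_of_notMem hy]; ring
  rw [eF]
  refine MemLp.add ?_ (MemLp.add ?_ (MemLp.sub (dt_memLp_archLayer_ae hv hm hH) (hv.const_mul _)))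
  · -- pole layer: a continuous function cut off to the compact window
    rw [memLp_indicator_iff_restrict measurableSet_Icc]
    have hcont : Continuous fun y : ℝ ↦
        2 * (∫ x, v x * (Real.cosh (x / 2) : ℂ)) * (Real.cosh (y / 2) : ℂ) -
          2 * (∫ x, v x * (Real.sinh (x / 2) : ℂ)) * (Real.sinh (y / 2) : ℂ) := by fun_prop
    obtain ⟨C, hC⟩ := isCompact_Icc.exists_bound_of_continuousOn (hcont.continuousOn (s := Icc (-c) c))
    exact MemLp.of_bound hcont.aestronglyMeasurable.restrict C
      ((ae_restrict_iff' measurableSet_Icc).2 (Eventually.of_forall fun y hy ↦ hC y hy))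
  · -- prime layer: finitely many translates
    refine MemLp.indicator measurableSet_Icc (memLp_finsetSum _ fun n _ ↦ ?_)
    exact (dt_memLp_secondDiff hv _).const_mul _

/-! ## The representation identity -/

/-- **Fubini for the archimedean layer** under an a.e. majorant: for `v, f ∈ L²`, `f` vanishing off `[-c, c]`,
`∫₀^∞ ρ(t) D_t(v, f) dt = ∫ Re[(𝟙_{[-c,c]}(y) ∫₀^∞ ρ(t)(2v(y) − v(y−t) − v(y+t)) dt) f̄(y)] dy`.
[cite: Bombieri2000Weil, §4 Lemma 1 eq. (4.2)] -/
theorem dt_archLayer_repr_ae (hv : MemLp v 2) (hf : MemLp f 2) (hfs : ∀ y, y ∉ Icc (-c) c → f y = 0)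
    {m : ℝ → ℝ} (hm : MemLp m 2)
    (hH : ∀ᵐ y : ℝ, y ∈ Ioo (-c) c →
      IntegrableOn (fun t ↦ weilArchDensity t * ‖2 * v y - v (y - t) - v (y + t)‖) (Ioi 0) ∧
        ∫ t in Ioi 0, weilArchDensity t * ‖2 * v y - v (y - t) - v (y + t)‖ ≤ m y) :
    ∫ t in Ioi 0, weilArchDensity t * weilIncrement₂ v f t =
      ∫ y, ((Icc (-c) c).indicator
        (fun y ↦ ∫ t in Ioi 0, (weilArchDensity t : ℂ) * (2 * v y - v (y - t) - v (y + t))) y *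
          conj (f y)).re := by
  -- the integrand on `ℝ × (0, ∞)`
  set Ψ : ℝ × ℝ → ℝ := fun p ↦
    weilArchDensity p.2 * ((2 * v p.1 - v (p.1 - p.2) - v (p.1 + p.2)) * conj (f p.1)).re with hΨ
  have hΨm : AEStronglyMeasurable Ψ ((volume : Measure ℝ).prod ((volume : Measure ℝ).restrict (Ioi 0))) := by
    have hρ : AEStronglyMeasurable (fun p : ℝ × ℝ ↦ weilArchDensity p.2)
        ((volume : Measure ℝ).prod ((volume : Measure ℝ).restrict (Ioi 0))) :=
      measurable_weilArchDensity.aestronglyMeasurable.comp_snd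
    have hfc : AEStronglyMeasurable (fun p : ℝ × ℝ ↦ conj (f p.1))
        ((volume : Measure ℝ).prod ((volume : Measure ℝ).restrict (Ioi 0))) :=
      Complex.continuous_conj.comp_aestronglyMeasurable hf.1.comp_fst
    exact hρ.mul (Complex.continuous_re.comp_aestronglyMeasurable
      ((dt_aesm_secondDiff_restrict hv.1).mul hfc))
  have hc1 : ∀ᵐ y : ℝ, y ∉ ({-c, c} : Set ℝ) :=
    measure_eq_zero_iff_ae_notMem.1 ((Set.toFinite ({-c, c} : Set ℝ)).measure_zero volume)
  -- slices: integrable for a.e. `y`, with `∫‖Ψ(y, ·)‖ ≤ |m y| ‖f y‖`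
  have hslice : ∀ᵐ y : ℝ,
      Integrable (fun t ↦ Ψ (y, t)) (volume.restrict (Ioi 0)) ∧
        ∫ t in Ioi 0, ‖Ψ (y, t)‖ ≤ ‖m y‖ * ‖f y‖ := by
    filter_upwards [hc1, hH] with y hy hHy
    by_cases hyI : y ∈ Icc (-c) c
    · have hyo : y ∈ Ioo (-c) c := by
        simp only [mem_insert_iff, mem_singleton_iff, not_or] at hy
        exact ⟨lt_of_le_of_ne hyI.1 (Ne.symm hy.1), lt_of_le_of_ne hyI.2 hy.2⟩
      obtain ⟨hHi, hHm⟩ := hHy hyo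
      have hmeas : AEStronglyMeasurable (fun t ↦ Ψ (y, t)) (volume.restrict (Ioi 0)) := by
        have h1 : AEStronglyMeasurable (fun t ↦ weilArchDensity t *
            ((2 * v y - v (y - t) - v (y + t)) * conj (f y)).re) volume :=
          measurable_weilArchDensity.aestronglyMeasurable.mul
            (Complex.continuous_re.comp_aestronglyMeasurable
              ((dt_aesm_secondDiff_slice hv.1 y).mul_const _))
        rw [hΨ]
        exact h1.restrict
      have hbound : ∀ t ∈ Ioi (0 : ℝ), ‖Ψ (y, t)‖ ≤
          weilArchDensity t * ‖2 * v y - v (y - t) - v (y + t)‖ * ‖f y‖ := by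
        intro t ht
        rw [hΨ]
        simp only
        rw [norm_mul, Real.norm_of_nonneg (weilArchDensity_pos ht).le, mul_assoc]
        refine mul_le_mul_of_nonneg_left ?_ (weilArchDensity_pos ht).le
        refine (Complex.abs_re_le_norm _).trans ?_
        rw [norm_mul, Complex.norm_conj]
      have hint : Integrable (fun t ↦ Ψ (y, t)) (volume.restrict (Ioi 0)) :=
        Integrable.mono' (hHi.mul_const ‖f y‖) hmeas
          ((ae_restrict_iff' measurableSet_Ioi).2 (Eventually.of_forall fun t ht ↦ by
            rw [Real.norm_eq_abs]; exact hbound t ht))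
      refine ⟨hint, ?_⟩
      calc ∫ t in Ioi 0, ‖Ψ (y, t)‖
          ≤ ∫ t in Ioi 0, weilArchDensity t * ‖2 * v y - v (y - t) - v (y + t)‖ * ‖f y‖ :=
            setIntegral_mono_on hint.norm (hHi.mul_const _) measurableSet_Ioi hbound
        _ = (∫ t in Ioi 0, weilArchDensity t * ‖2 * v y - v (y - t) - v (y + t)‖) * ‖f y‖ :=
            integral_mul_const _ _
        _ ≤ m y * ‖f y‖ := mul_le_mul_of_nonneg_right hHm (norm_nonneg _)
        _ ≤ ‖m y‖ * ‖f y‖ := mul_le_mul_of_nonneg_right (le_abs_self _) (norm_nonneg _)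
    · have h0 : ∀ t, Ψ (y, t) = 0 := fun t ↦ by simp [hΨ, hfs y hyI]
      refine ⟨(integrable_zero _ _ _).congr (Eventually.of_forall fun t ↦ (h0 t).symm), ?_⟩
      simp only [h0, norm_zero, integral_zero]
      positivity
  have hΨi : Integrable Ψ ((volume : Measure ℝ).prod ((volume : Measure ℝ).restrict (Ioi 0))) := by
    rw [integrable_prod_iff hΨm]
    constructor
    · filter_upwards [hslice] with y hy using hy.1
    · refine Integrable.mono' (hm.norm.integrable_mul hf.norm) hΨm.norm.integral_prod_right' ?_
      filter_upwards [hslice] with y hy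
      rw [Real.norm_of_nonneg (integral_nonneg fun _ ↦ norm_nonneg _)]
      simpa only [Pi.mul_apply, Real.norm_eq_abs, abs_norm] using hy.2
  -- swap the integrals
  have hswap := integral_integral_swap (f := fun y t ↦ Ψ (y, t)) hΨi
  -- identify the `t`-slices with `ρ(t) D_t(v, f)`
  have ht : ∀ t, ∫ y, Ψ (y, t) = weilArchDensity t * weilIncrement₂ v f t := by
    intro t
    rw [dt_weilIncrement₂_eq_secondDiff hv hf, ← integral_const_mul]
  simp_rw [ht] at hswap
  rw [← hswap]
  -- identify the `y`-slices
  refine integral_congr_ae ?_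
  filter_upwards [hc1, hH] with y hy hHy
  by_cases hyI : y ∈ Icc (-c) c
  · have hyo : y ∈ Ioo (-c) c := by
      simp only [mem_insert_iff, mem_singleton_iff, not_or] at hy
      exact ⟨lt_of_le_of_ne hyI.1 (Ne.symm hy.1), lt_of_le_of_ne hyI.2 hy.2⟩
    rw [indicator_of_mem hyI]
    have hG : Integrable (fun t ↦ (weilArchDensity t : ℂ) * (2 * v y - v (y - t) - v (y + t)))
        (volume.restrict (Ioi 0)) := by
      refine Integrable.mono' (hHy hyo).1
        (((Complex.continuous_ofReal.measurable.comp measurable_weilArchDensity).aestronglyMeasurable.mul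
          (dt_aesm_secondDiff_slice hv.1 y)).restrict)
        ((ae_restrict_iff' measurableSet_Ioi).2 (Eventually.of_forall fun t ht ↦ ?_))
      rw [norm_mul, Complex.norm_real, Real.norm_of_nonneg (weilArchDensity_pos ht).le]
    have h2 := integral_re (hG.mul_const (conj (f y)))
    simp only [RCLike.re_to_complex] at h2
    rw [← integral_mul_const, ← h2]
    refine integral_congr_ae (Eventually.of_forall fun t ↦ ?_)
    simp only [hΨ]
    rw [show (weilArchDensity t : ℂ) * (2 * v y - v (y - t) - v (y + t)) * conj (f y) =
      (weilArchDensity t : ℂ) * ((2 * v y - v (y - t) - v (y + t)) * conj (f y)) by ring,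
      Complex.re_ofReal_mul]
  · rw [indicator_of_notMem hyI]
    simp [hΨ, hfs y hyI]

/-- **The window image represents the closed form** under an a.e. majorant.  Let `v ∈ L²` have absolutely
convergent archimedean second differences at almost every point of the open window, dominated there by `m ∈ L²`,
and let `F` be given by the window-image formula.  Then for every `f ∈ L²` vanishing off `[-c, c]`,
`P(v, f) + 𝓔_c(v, f) − M_c ∫ Re(v f̄) = ∫ Re(F f̄)`. [cite: Bombieri2000Weil, §4 Lemma 1 eq. (4.2)] -/
theorem dt_windowImage_repr_ae {F : ℝ → ℂ} (hv : MemLp v 2) {m : ℝ → ℝ} (hm : MemLp m 2)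
    (hH : ∀ᵐ y : ℝ, y ∈ Ioo (-c) c →
      IntegrableOn (fun t ↦ weilArchDensity t * ‖2 * v y - v (y - t) - v (y + t)‖) (Ioi 0) ∧
        ∫ t in Ioi 0, weilArchDensity t * ‖2 * v y - v (y - t) - v (y + t)‖ ≤ m y)
    (hF : ∀ y, F y = (Icc (-c) c).indicator (fun y ↦
        2 * (∫ x, v x * (Real.cosh (x / 2) : ℂ)) * (Real.cosh (y / 2) : ℂ) -
          2 * (∫ x, v x * (Real.sinh (x / 2) : ℂ)) * (Real.sinh (y / 2) : ℂ) +
        (∑ n ∈ weilPrimeIndex c, (((ArithmeticFunction.vonMangoldt n : ℝ) / Real.sqrt n : ℝ) : ℂ) *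
          (2 * v y - v (y - Real.log n) - v (y + Real.log n))) +
        ∫ t in Ioi 0, (weilArchDensity t : ℂ) * (2 * v y - v (y - t) - v (y + t))) y -
      (weilMarkovConstant c : ℂ) * v y)
    (hf : MemLp f 2) (hfs : ∀ y, y ∉ Icc (-c) c → f y = 0) :
    weilPoleForm₂ v f + weilDirichletEnergy₂ c v f - weilMarkovConstant c * ∫ x, (v x * conj (f x)).re =
      ∫ x, (F x * conj (f x)).re := by
  -- the four layers of `F`
  set FP : ℝ → ℂ := fun y ↦ 2 * (∫ x, v x * (Real.cosh (x / 2) : ℂ)) * (Real.cosh (y / 2) : ℂ) -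
      2 * (∫ x, v x * (Real.sinh (x / 2) : ℂ)) * (Real.sinh (y / 2) : ℂ) with hFP
  set FS : ℝ → ℂ := fun y ↦ ∑ n ∈ weilPrimeIndex c,
      (((ArithmeticFunction.vonMangoldt n : ℝ) / Real.sqrt n : ℝ) : ℂ) *
        (2 * v y - v (y - Real.log n) - v (y + Real.log n)) with hFS
  set FA : ℝ → ℂ := fun y ↦ (Icc (-c) c).indicator
      (fun y ↦ ∫ t in Ioi 0, (weilArchDensity t : ℂ) * (2 * v y - v (y - t) - v (y + t))) y with hFA
  have hprod : ∀ y, F y * conj (f y) =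
      FP y * conj (f y) + FS y * conj (f y) + FA y * conj (f y) -
        (weilMarkovConstant c : ℂ) * (v y * conj (f y)) := by
    intro y
    rw [hF y]
    by_cases hy : y ∈ Icc (-c) c
    · simp only [indicator_of_mem hy, hFP, hFS, hFA]; ring
    · simp only [hfs y hy, map_zero, mul_zero, add_zero, sub_zero]
  -- integrability of the layers against `f̄`
  have iP : Integrable fun y ↦ (FP y * conj (f y)).re := by
    have h1 : Integrable fun y ↦ conj (f y) * FP y :=
      dt_integrable_mul_continuous (a := c) (memLp_conj hf) (fun y hy ↦ by simp [hfs y hy]) (by fun_prop)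
    have h2 : Integrable fun y ↦ FP y * conj (f y) := h1.congr (Eventually.of_forall fun y ↦ mul_comm _ _)
    simpa only [RCLike.re_to_complex] using h2.re
  have hFSm : MemLp FS 2 := by
    rw [hFS]
    exact memLp_finsetSum _ fun n _ ↦ (dt_memLp_secondDiff hv _).const_mul _
  have iS : Integrable fun y ↦ (FS y * conj (f y)).re := dt_integrable_mul_conj_re hFSm hf
  have iA : Integrable fun y ↦ (FA y * conj (f y)).re :=
    dt_integrable_mul_conj_re (dt_memLp_archLayer_ae hv hm hH) hf
  have iM : Integrable fun y ↦ ((weilMarkovConstant c : ℂ) * (v y * conj (f y))).re := by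
    have h0 : Integrable fun y ↦ v y * conj (f y) := hv.integrable_mul (memLp_conj hf)
    have h1 := h0.const_mul (weilMarkovConstant c : ℂ)
    simpa only [RCLike.re_to_complex] using h1.re
  -- the pole layer
  have hP : weilPoleForm₂ v f = ∫ y, (FP y * conj (f y)).re := by
    set Av : ℂ := ∫ x, v x * (Real.cosh (x / 2) : ℂ) with hAv
    set Bv : ℂ := ∫ x, v x * (Real.sinh (x / 2) : ℂ) with hBv
    have hfs' : ∀ y, y ∉ Icc (-c) c → conj (f y) = 0 := fun y hy ↦ by simp [hfs y hy]
    have icc : Integrable fun y ↦ conj (f y) * (Real.cosh (y / 2) : ℂ) :=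
      dt_integrable_mul_continuous (memLp_conj hf) hfs' (by fun_prop)
    have iss : Integrable fun y ↦ conj (f y) * (Real.sinh (y / 2) : ℂ) :=
      dt_integrable_mul_continuous (memLp_conj hf) hfs' (by fun_prop)
    have ecc : ∫ y, conj (f y) * (Real.cosh (y / 2) : ℂ) = conj (∫ y, f y * (Real.cosh (y / 2) : ℂ)) := by
      rw [← integral_conj]; congr 1 with y; rw [map_mul, Complex.conj_ofReal]
    have ess : ∫ y, conj (f y) * (Real.sinh (y / 2) : ℂ) = conj (∫ y, f y * (Real.sinh (y / 2) : ℂ)) := by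
      rw [← integral_conj]; congr 1 with y; rw [map_mul, Complex.conj_ofReal]
    have hint : Integrable fun y ↦ FP y * conj (f y) := by
      have h0 := (icc.const_mul (2 * Av)).sub (iss.const_mul (2 * Bv))
      refine h0.congr (Eventually.of_forall fun y ↦ ?_)
      simp only [hFP, Pi.sub_apply]
      ring
    have h1 := integral_re hint
    simp only [RCLike.re_to_complex] at h1
    have e2 : ∫ y, FP y * conj (f y) =
        2 * Av * conj (∫ y, f y * (Real.cosh (y / 2) : ℂ)) -
          2 * Bv * conj (∫ y, f y * (Real.sinh (y / 2) : ℂ)) := by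
      have hsplit : (fun y ↦ FP y * conj (f y)) = fun y ↦
          2 * Av * (conj (f y) * (Real.cosh (y / 2) : ℂ)) - 2 * Bv * (conj (f y) * (Real.sinh (y / 2) : ℂ)) := by
        funext y; simp only [hFP]; ring
      rw [hsplit, integral_sub (icc.const_mul (2 * Av)) (iss.const_mul (2 * Bv)), integral_const_mul,
        integral_const_mul, ecc, ess]
    rw [h1, e2]
    unfold weilPoleForm₂
    rw [show (2 : ℂ) * Av * conj (∫ y, f y * (Real.cosh (y / 2) : ℂ)) -
        2 * Bv * conj (∫ y, f y * (Real.sinh (y / 2) : ℂ)) =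
      ((2 : ℝ) : ℂ) * (Av * conj (∫ y, f y * (Real.cosh (y / 2) : ℂ))) -
        ((2 : ℝ) : ℂ) * (Bv * conj (∫ y, f y * (Real.sinh (y / 2) : ℂ))) by push_cast; ring,
      Complex.sub_re, Complex.re_ofReal_mul, Complex.re_ofReal_mul]
  -- the prime layer
  have hS : ∑ n ∈ weilPrimeIndex c, (ArithmeticFunction.vonMangoldt n : ℝ) / Real.sqrt n *
      weilIncrement₂ v f (Real.log n) = ∫ y, (FS y * conj (f y)).re := by
    have hn : ∀ n ∈ weilPrimeIndex c, Integrable (fun y ↦ (ArithmeticFunction.vonMangoldt n : ℝ) / Real.sqrt n *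
        ((2 * v y - v (y - Real.log n) - v (y + Real.log n)) * conj (f y)).re) := fun n _ ↦
      (dt_integrable_mul_conj_re (dt_memLp_secondDiff hv _) hf).const_mul _
    have e1 : ∀ y, (FS y * conj (f y)).re = ∑ n ∈ weilPrimeIndex c,
        (ArithmeticFunction.vonMangoldt n : ℝ) / Real.sqrt n *
          ((2 * v y - v (y - Real.log n) - v (y + Real.log n)) * conj (f y)).re := by
      intro y
      simp only [hFS, Finset.sum_mul, Complex.re_sum]
      refine Finset.sum_congr rfl fun n _ ↦ ?_
      rw [mul_assoc, Complex.re_ofReal_mul]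
    simp_rw [e1]
    rw [integral_finsetSum _ hn]
    refine Finset.sum_congr rfl fun n _ ↦ ?_
    rw [integral_const_mul, dt_weilIncrement₂_eq_secondDiff hv hf]
  -- the archimedean layer
  have hA : ∫ t in Ioi 0, weilArchDensity t * weilIncrement₂ v f t = ∫ y, (FA y * conj (f y)).re :=
    dt_archLayer_repr_ae hv hf hfs hm hH
  -- the killing layer
  have hM : weilMarkovConstant c * ∫ x, (v x * conj (f x)).re =
      ∫ y, ((weilMarkovConstant c : ℂ) * (v y * conj (f y))).re := by
    rw [← integral_const_mul]
    congr 1 with y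
    rw [Complex.re_ofReal_mul]
  -- assemble
  have iSA : Integrable fun y ↦ (FS y * conj (f y)).re + (FA y * conj (f y)).re := iS.add iA
  have iPSA : Integrable fun y ↦ (FP y * conj (f y)).re + ((FS y * conj (f y)).re + (FA y * conj (f y)).re) :=
    iP.add iSA
  unfold weilDirichletEnergy₂
  rw [hP, hS, hA, hM, ← integral_add iS iA, ← integral_add iP iSA, ← integral_sub iPSA iM]
  congr 1 with y
  rw [hprod y]
  simp only [Complex.add_re, Complex.sub_re]
  ring

end Summit.RiemannHypothesis.RiemannHypothesis.Theorems.EvenWinsBeyondArch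

end
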